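import Summits.AtomisticToContinuum.Crystallization.Theorems.ChargedEnergyGapVolterraTransfer
import HarnessLib

/-!
(SPLIT FOR THE 400-LINE CAP by the landing lane, hand-2 g29: this file = part A; part B = `…ChargedEnergyGapSeamTransfer` imports it; same namespace, all FQNs unchanged.)
# `ChargedEnergyGap` — the SEAM TRANSFER BOUND: a Burgers FLOOR in place of quantisation, free far excision, and the budget far leaf re-glued
LANDING BANNER (critic row 1115 (6); landing lane hand-2 g31): the (H𝄪)/(N𝄪)-type RECORD pieces of this lens-3 g53–g56 engine are VACUOUS at μ₀ > 0 — `harmStableWith_nonpos` (lens-3 g61, `…ChargedEnergyGapRotationGauge`); superseded by the …R designate ((H𝄪ʳ) `LocalSeamTransferBoundR`, (N𝄪ʳ) `LocalSeamReductionR` of `…ChargedEnergyGapRotationRepair`).  Landed as an ENGINE: the transfer / reduction lemmas below are consumed by P-I.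
# (cell `decomp-a2c`, lens 3, generation 55, node «SeamTransfer», part P-C; over part P-B `…Theorems.ChargedEnergyGapVolterraTransfer`)

WHAT P-B LEFT IDEA-NEEDED (memo g54 §3, critic row 1053: «residual := REFERENCE SWITCHING ONLY — ribbons wider than ϱ/8, grains, twins»).
Census C14-30 then measured the Lennard-Jones numbers that make reference switching GENERIC rather than exotic: the e* phase hcp has a
positive but tiny basal stacking-fault energy `γ_I2 = +2.79·10⁻⁴` per unit area, so a relaxed basal dislocation dissociates into two
Shockley partials (`‖b_p‖ = a/√3 = 0.5608`) separated by a faulted ribbon `324–664` spacings wide — `×16–×33` the free core-zone radius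
`ϱ/8 = 20` and `×2–×4` the whole profile scale `ϱ = 160`; in fcc `γ_ISF = −1.26·10⁻⁴ < 0` and partials repel without bound.  A far region
with dislocation content is therefore TWO-REFERENCE (matrix + differently stacked ribbon) on the scale of the shell, and (H♯)/(N♯) —
whose cut pieces carry Burgers vectors in the stabiliser `T(P)` of ONE reference point set — do not serve it.

THE ANALYSIS (memo g55 §1–§2).  A stacking seam — a bounded planar piece of a close-packed plane across which the crystal on one side is
translated by a partial vector `t ∉ T(P)` relative to the labels continued from the other side — is ALREADY a Volterra cut piece of part
P-B with `t` in the slot of the Burgers vector: the bond field `β = β₀ + J_S` charts the actual configuration with `β₀ = δ(S + v)`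
absorbing the piecewise translation `S` (a global cocycle), the jump `J` cancelling `δS` on every bond crossing the seam, and the SAME
strain constraint.  Nothing in the functional, the weights or the stability hypotheses refers to `T(P)`; the single clause that blocks
seams in (H♯) is the QUANTISATION `b ∈ T(P)` of `IsCutSystem`.  And in the truth analysis of (H♯) (memo g54 §1–§2) quantisation was used
exactly once, as a FLOOR: `‖b‖ ≥ s` forces every nearest-neighbour triangle linked with an uncancelled rim to carry a bond value
`≥ ‖b‖/3 > τ·R`, hence a PRICED excised collar — the mechanism that makes uncored dislocation content pay for itself.  DEGENERATE-WITNESS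
PASS (why a floor, and not nothing, must replace quantisation): with UNFLOORED Burgers vectors a disc of radius `r_S` carrying `‖b‖ ≈ 0.03`
passes the strain constraint unexcised, its linear rim term (`∝ ‖b‖` per unit rim length, from the attractive-tail imbalance of the
weighted linear coefficients) beats its quadratic cost (`∝ ‖b‖²`), gain `≈ 0.02` per unit rim length per disc, finitely many discs per
cell anywhere on the plateau ⇒ FALSE.  With a floor `b₀` such that `b₀/3 > τ·R` (record `2/5`: `0.133 > 0.036`) the collar mechanism is
intact, and every Shockley partial of a close-packed layer of spacing `≥ 7/10` meets the floor (`(2/5)² ≤ (7/10)²/3`).  The model is BLIND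
to complete (rimless, uncored) seams — `β₀` absorbs them — which is correct to first order because the reference is STRESS-FREE (zero
traction on every plane: the slot error of expanding crossing pairs about `z − y` instead of `z − y − t` has vanishing first moment);
the true unrelaxed fault energy `γ·Area ≥ 0` and its strain derivative are the REDUCTION's bookkeeping (memo g55 §2: in the e* phase
`γ_I2 − τ·|∂γ/∂ε| ≈ 2.8·10⁻⁴ − 0.9·10⁻⁴ > 0` per unit area, estimate pending census C16 (a); in a c-stacked matrix `γ < 0` is paid
by the bulk surplus `≥ 3.5·10⁻⁵` per site of every non-hcp stacking, census C13C-30).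

THE TWO MOVES (no new datum kind, no new currency).
 (1) BURGERS FLOOR.  `IsSeamSystem b₀ r_S P S` := `IsCutSystem` VERBATIM with `b ∈ T(P)` replaced by `b = 0 ∨ b₀ ≤ ‖b‖`.  Since `T(P) ∖ {0}`
     is floored by the separation `s` (`norm_le_of_mem_transSet`), every cut system is a seam system for `b₀ ≤ s`
     (`isSeamSystem_of_isCutSystem`): the new transfer bound is STRONGER than (H♯) (proved), so (H♭), (H) and the census kill path of
     record (C10/C11/C13/C15) stay valid verbatim.  Admitted now: Shockley seams of any extent `≥ 2r_S` (ribbons of any width between cored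
     partials), coherent Σ3 twin lamellae (seam stacks `t, t, −2t ≡ t` per layer), arbitrary stacking disorder of one layer-normal, oblique
     seam families of a second {111} system with cored junction lines.
 (2) FREE FAR EXCISION.  `pricedNearCount P X ϱ C` := excised motif sites having a NON-excised site of positive profile weight within
     `3ϱ/8`; it replaces `pricedExcisedCount` (excised sites farther than `ϱ/8` from `C`).  Near-priced `≤` priced
     (`pricedNearCount_le_pricedExcisedCount`: a weighted site is farther than `ϱ/2` from `C`, so anything within `3ϱ/8` of it is farther
     than `ϱ/8`) — again STRONGER.  Soundness is the free core zone's own: every bond from free excised territory to a weighted site has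
     length `≥ 3ϱ/8 = 60` at the record (tail `|V′(60)| ≈ 2·10⁻¹¹`), and any excision FACING weighted sites keeps a priced collar `3ϱ/8`
     deep.  What it buys the reduction: a second GRAIN behind a cored (gross) wall is excised for free beyond `3ϱ/8` of the weighted sites
     of the first, so a far component meeting several grains is served grain by grain (one instance of the bound per grain reference),
     other-gross wall patches being priced within `3ϱ/8` and paid by the `ρ₀`-debit (`C₁` existential absorbs `C_H`).

THE SPLIT (modus ponens, re-glued; generic in `W`; dials `s lam ℓ μ₀ τ λ ϱ r_S C_T` of P-B, `b₀` new):
  (Hˢ) SEAM-TRANSFER(C_T, b₀, r_S)  `SeamTransferBoundC s lam ℓ μ₀ τ λ ϱ b₀ r_S C_T` — (H♯) with moves (1)(2) · STRONGER than (H♯) for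
                           `b₀ ≤ s` (`volterraTransferBoundC_of_seam`), than (H♭) at every `b₀` (`harmonicTransferBoundC_of_seam`), than (H) ·
                           UNDECIDED → TRUE-leaning (memo g55 §2: the new test data are (i) floored small-Burgers pieces — collar-priced as
                           before, (ii) complete seams — invisible, (iii) layer-periodic «wobble» cocycles riding on seam stacks — already
                           admissible in (H♭), linear term `≈ 1.7·10⁻⁵·ω` against quadratic `2.5·ω²` per shell site, harmless, (iv) far
                           excisions — tail-priced at range `60`; side conjecture of record unchanged: kill sign `< −3.33·10⁻⁷` per shell
                           site at `λ = 1/2`) · INSTRUMENTABLE (C15 verbatim; new C16 (b)) · ATTACKABLE-M+ (P-B's programme; the floor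
                           enters only through the collar lemma);
  (Nˢ) SEAM-REDUCTION_W    `SeamReductionW … W c₁ ρ₀ B₀` := (Hˢ) ⟹ CB-FAR_W|cored,B₀ — WEAKER than (N♯)
                           (`seamReductionW_of_volterraReduction`, `b₀ ≤ s`), than (N♭), than the leaf (`seamReductionW_of_budget`) ·
                           UNDECIDED (TRUE-leaning with the leaf) ·
                           ATTACKABLE-L on every clean labelled far component that is, GRAIN BY GRAIN (grains separated by cored / other-gross
                           walls, move (2)), ONE Barlow lattice ORIENTATION up to elastic distortion with ARBITRARY STACKING-SEAM CONTENT
                           (faults, ribbons of any width, first-generation Σ3 twin lamellae, stacking disorder, oblique {111} seam families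
                           with cored junctions) and arbitrary centred perfect / partial dislocation content, plus priced holes — bookkeeping:
                           fault energy minus strain derivative `≥ 0` per seam area in the e* phase (layerwise optimality of hcp, census
                           C16 (c)), bulk surplus in c-stacked matrices · IDEA-NEEDED residual (γ′): NETWORKS of `≥ 3` mutually rotated twin
                           variants meeting along coherent faces (Σ3ⁿ chains, cyclic twins) in c-rich regions — not one orientation, not
                           free-excisable (coherent faces), priced collars unaffordable for thin domains; the physical budget exists (c-layer
                           surplus `7.25·10⁻⁵` per site) and wants a χ-LOCALISED transfer bound (product weights, transition sites paid `C_T`)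
                           — generation 56; (ε) charted-charged coherent misoriented walls, if LJ has any (census C16 (d));
  glue (proved)            (Hˢ) ∧ (Nˢ) ⟹ CB-FAR_W|cored,B₀ (`farLabelledFloorCoredBudgetW_of_seam`).
WHY THIS IS NOVEL.  Partial dislocations and stacking faults enter an atomistic energy-account inequality not through a γ-surface or a
second reference configuration but through the observation that the Volterra test class needs only a FLOOR on the jump, not its
quantisation: the seam translation is a free internal shift of the test datum (the discrete analogue of the shift vector of multilattice
Cauchy–Born, E–Ming 2007), the stress-free reference makes complete seams first-order invisible, and grains are decoupled by a pricing
rule (free excision beyond `3ϱ/8` of the weighted sites) instead of a second chart.  Searched: corpus (fts + vec) and galaxy for «Shockley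
partial | stacking fault energy | generalized stacking fault», «partial dislocation discrete-to-continuum Γ-convergence», «Cauchy–Born
complex lattice internal shift»: textbook dissociation widths (Cai–Nix 2016 §11.1.4), γ-surface Peierls–Nabarro from atomistics
(arXiv:1706.03145), multilattice Cauchy–Born (doi:10.1007/s00205-006-0031-7), bounded interpolation of lattices (Duneau–Oguey 1991) — no
uniform weighted-account bound over floored cut data.

§1 Seam systems (the floor), ★ `T(P)` is `s`-floored, cut ⟹ seam, antisymmetry; near-pricing, ★ near ≤ priced, degenerate instances.
§2 The two pieces; ★ (Hˢ) ⟹ (H♯) ⟹ (H♭) ⟹ (H); (N♯) ⟹ (Nˢ); glue; WEAKER; dials incl. the new floor dial `b₀`.  §3 Record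
`(μ₀, τ, λ, b₀, r_S, C_T) = (1/100, 3/100, 1/2, 2/5, 3, 1/(3·10⁶))`: ★★ the ten-leaf cone for every `W`, ★★ the max-cover cone at
`ϱ = 160`, the P-B cone recovered, the record arithmetic.

TAGS.  SEAM-TRANSFER(1/(3·10⁶), 2/5, 3): UNDECIDED→TRUE-leaning · INSTRUMENTABLE (via (H): C10/C11/C13/C15; new C16 (b)) · ATTACKABLE-M+ ·
STRONGER than (H♯) (proved, `b₀ ≤ s`).  SEAM-REDUCTION_W: WEAKER than VOLTERRA-REDUCTION_W, HARM-REDUCTION_W and CB-FAR_W|cored,10⁵ (all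
proved) · UNDECIDED · ATTACKABLE-L (single-orientation grains with arbitrary stacking-seam and dislocation content, grains decoupled by free
far excision) | IDEA-NEEDED (γ′) multi-variant twin networks, (ε) charted coherent misoriented walls.  No new EQUIV (the lineage's EQUIV
of record stays `farLabelledFloorCoredW_iff_budget_packing`, part O-D).  The floor dial is load-bearing: at `b₀ ≤ 0` the floor is void
and SEAM-TRANSFER is the unfloored statement refuted by the rim-disc family above (memo g55 §1 (xxi)). -/

noncomputable section

open scoped Classical
open Literature.MathematicalPhysics.StatisticalMechanics
open Literature.Geometry.DiscreteGeometry
open Summit.AtomisticToContinuum.Crystallization.Theses.PricedLinkCensus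
open Summit.AtomisticToContinuum.Crystallization.Theorems.ChargedEnergyGapNegative

namespace Summit.AtomisticToContinuum.Crystallization.Theorems.ChargedEnergyGapChartDial

/-! ## §1 Seam systems (the Burgers floor) and near-pricing (free far excision) -/

section Seams

variable (b₀ r_S : ℝ) (P : PeriodicConfiguration 3) {k : ℕ} (S : Fin k → CutPiece)

/-- A **SEAM SYSTEM** of floor `b₀` and in-radius `r_S` for the reference `P`: `IsCutSystem r_S P S` VERBATIM (planar pieces, planar
in-radius `≥ r_S`, transversal crossings by reference bonds) except that the Burgers vector of each piece is FLOORED — `b = 0 ∨ b₀ ≤ ‖b‖` —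
instead of quantised in `T(P)`.  Stacking seams (partial translations), twin seam stacks and perfect-dislocation cuts are all seam
systems; for `b₀ ≤ s` every cut system is one (`isSeamSystem_of_isCutSystem`). -/
def IsSeamSystem : Prop :=
  (∀ i, inner ℝ (S i).normal (S i).edge₁ = 0 ∧ inner ℝ (S i).normal (S i).edge₂ = 0) ∧
  (∀ i, (S i).burgers = 0 ∨ b₀ ≤ ‖(S i).burgers‖) ∧
  (∀ i, (S i).HasInradius r_S) ∧
  (∀ i, ∀ g ∈ P.lattice, ∀ y ∈ P.points, ∀ z ∈ P.points,
    ((S i).shift g).Crosses y z → inner ℝ (z - y) (S i).normal ≠ 0)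

variable {b₀ r_S P S}

/-- Degenerate instance: the EMPTY system is a seam system at every floor and in-radius. -/
theorem isSeamSystem_fin_zero (S : Fin 0 → CutPiece) : IsSeamSystem b₀ r_S P S :=
  ⟨fun i => i.elim0, fun i => i.elim0, fun i => i.elim0, fun i => i.elim0⟩

/-- Seam systems are antitone in the in-radius threshold … -/
theorem IsSeamSystem.anti {r_S' : ℝ} (hr : r_S ≤ r_S') (h : IsSeamSystem b₀ r_S' P S) : IsSeamSystem b₀ r_S P S :=
  ⟨h.1, h.2.1, fun i => (h.2.2.1 i).anti hr, h.2.2.2⟩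

/-- … and antitone in the floor (a lower floor admits more systems). -/
theorem IsSeamSystem.anti_floor {b₀' : ℝ} (hb : b₀ ≤ b₀') (h : IsSeamSystem b₀' r_S P S) : IsSeamSystem b₀ r_S P S :=
  ⟨h.1, fun i => (h.2.1 i).imp_right fun h' => hb.trans h', h.2.2.1, h.2.2.2⟩

/-- ★ **THE STABILISER IS FLOORED BY THE SEPARATION**: a non-zero stabiliser translation of an `s`-separated reference has norm `≥ s`
(it moves a reference point to another reference point).  This is the ONLY use (H♯)'s truth analysis ever made of quantisation. -/
theorem norm_le_of_mem_transSet {s : ℝ} (hs : IsSeparatedRef s P) {t : E3} (ht : t ∈ transSet P) (h0 : t ≠ 0) : s ≤ ‖t‖ := by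
  obtain ⟨p, hp⟩ := P.points_nonempty
  have hpt : p + t ∈ P.points := (ht p).2 hp
  have hne : p ≠ p + t := by
    intro h
    apply h0
    have h' : p + t - p = p - p := by rw [← h]
    simpa using h'
  have hd : dist p (p + t) = ‖t‖ := by
    rw [dist_eq_norm, sub_add_cancel_left, norm_neg]
  exact hd ▸ hs p hp (p + t) hpt hne

/-- ★ **CUT ⟹ SEAM**: every cut system of an `s`-separated reference is a seam system of any floor `b₀ ≤ s`. -/
theorem isSeamSystem_of_isCutSystem {s : ℝ} (hs : IsSeparatedRef s P) (hb : b₀ ≤ s) (h : IsCutSystem r_S P S) :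
    IsSeamSystem b₀ r_S P S := by
  refine ⟨h.1, fun i => ?_, h.2.2.1, h.2.2.2⟩
  by_cases h0 : (S i).burgers = 0
  · exact Or.inl h0
  · exact Or.inr (hb.trans (norm_le_of_mem_transSet hs (h.2.1 i) h0))

/-- ★ On reference bonds the cut jump of a SEAM system is ANTISYMMETRIC (transversality only — quantisation was never used). -/
theorem cutJump_swap_of_seam (h : IsSeamSystem b₀ r_S P S) {y z : E3} (hy : y ∈ P.points) (hz : z ∈ P.points) :
    cutJump P S z y = -cutJump P S y z := by
  simp only [cutJump]
  rw [← Finset.sum_neg_distrib]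
  refine Finset.sum_congr rfl fun i _ => ?_
  rw [← finsum_neg_distrib]
  refine finsum_congr fun g => ?_
  exact CutPiece.jump_swap _ (h.2.2.2 i (g : E3) g.2 y hy z hz)

/-- ★ … hence so is the Volterra bond field of a global cocycle and a seam system. -/
theorem volterraField_swap_of_seam {β₀ : E3 → E3 → E3} (h₀ : IsGlobalCocycle P β₀) (h : IsSeamSystem b₀ r_S P S) {y z : E3}
    (hy : y ∈ P.points) (hz : z ∈ P.points) : volterraField P S β₀ z y = -volterraField P S β₀ y z := by
  simp only [volterraField, h₀.1 y hy z hz, cutJump_swap_of_seam h hy hz, neg_add]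

variable (P) (X : Set E3) (ϱ : ℝ) (C : Set E3)

/-- The **NEAR-PRICED EXCISED COUNT** (free far excision): excised motif sites that have a NON-excised reference site of positive
profile weight within `3ϱ/8`.  Excised sites with no weighted site that close are FREE — the free core zone (within `ϱ/8` of `C`) is the
special case facing the zone boundary, a whole second grain behind a cored wall the new one. -/
def pricedNearCount : ℕ :=
  (P.motif.filter fun y => y ∈ X ∧ ∃ z ∈ P.points, z ∉ X ∧ 0 < profileWeight ϱ C z ∧ dist y z < 3 * ϱ / 8).card

variable {P X ϱ C}

/-- A site of positive profile weight is farther than `ϱ/2` from the centre set (`0 < ϱ`). -/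
theorem half_lt_infDist_of_profileWeight_pos (hϱ : 0 < ϱ) {q : E3} (h : 0 < profileWeight ϱ C q) :
    ϱ / 2 < Metric.infDist q C := by
  by_contra hle
  have hle' : Metric.infDist q C ≤ ϱ / 2 := not_lt.1 hle
  have h2 : 2 * Metric.infDist q C / ϱ ≤ 1 := (div_le_one hϱ).2 (by linarith)
  have h1 : (1 : ℝ) ≤ 2 - 2 * Metric.infDist q C / ϱ := by linarith
  have h0 : profileWeight ϱ C q = 0 := by
    unfold profileWeight
    rw [smoothStep_of_one_le h1]
    norm_num
  exact absurd h0 (ne_of_gt h)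

/-- ★ **NEAR-PRICED ≤ PRICED**: an excised site within `3ϱ/8` of a weighted site is farther than `ϱ/8` from the centre set — free far
excision only ENLARGES the free set, so the new transfer bound is stronger. -/
theorem pricedNearCount_le_pricedExcisedCount : pricedNearCount P X ϱ C ≤ pricedExcisedCount P X ϱ C := by
  unfold pricedNearCount pricedExcisedCount
  refine Finset.card_le_card fun y hy => ?_
  rw [Finset.mem_filter] at hy ⊢
  obtain ⟨hyM, hyX, z, _, _, hw, hd⟩ := hy
  refine ⟨hyM, hyX, ?_⟩
  rcases le_or_gt ϱ 0 with hϱ | hϱ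
  · exact absurd hd (not_lt.2 ((by linarith : 3 * ϱ / 8 ≤ 0).trans dist_nonneg))
  · have hz := half_lt_infDist_of_profileWeight_pos hϱ hw
    have htri : Metric.infDist z C ≤ Metric.infDist y C + dist z y := Metric.infDist_le_infDist_add_dist
    rw [dist_comm] at htri
    linarith

/-- Degenerate instance: with NO centres nothing is weighted, so nothing is near-priced … -/
theorem pricedNearCount_empty_centres : pricedNearCount P X ϱ (∅ : Set E3) = 0 := by
  unfold pricedNearCount
  rw [Finset.card_eq_zero, Finset.filter_eq_empty_iff]
  rintro y - ⟨-, z, -, -, hw, -⟩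
  rw [profileWeight_empty] at hw
  exact lt_irrefl _ hw

/-- … and at a non-positive profile scale nothing is near-priced either (`dist < 3ϱ/8 ≤ 0` is impossible). -/
theorem pricedNearCount_of_nonpos (hϱ : ϱ ≤ 0) : pricedNearCount P X ϱ C = 0 := by
  unfold pricedNearCount
  rw [Finset.card_eq_zero, Finset.filter_eq_empty_iff]
  rintro y - ⟨-, z, -, -, -, hd⟩
  exact absurd hd (not_lt.2 ((by linarith : 3 * ϱ / 8 ≤ 0).trans dist_nonneg))

end Seams

end Summit.AtomisticToContinuum.Crystallization.Theorems.ChargedEnergyGapChartDial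

end
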